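import Mathlib
import Summits.ValiantsHypothesis.ValiantsHypothesis.Theorems.TwoProducts.Negative.CommonPadding
import HarnessLib

/-!
# NEGATIVE lane (val-neg-1 g5): TOWER PADDING — common gadget pairs at arbitrary scales, and binary towers violate every fibre-spread bound

Helper file for crux `stmt-ValiantsHypothesis-5906` (filed `--supports`; closes NO item, proves NO summit statement, does NOT prove
`TwoProducts`, `PlanarCellBound`, any `ResidualLawV…`, `ConfinedTameLaw` or VP ≠ VNP; 0 `def`s).  Sequel to `Negative/FullPadding.lean` (same seat).

(1) `scaledPadding_spec` / `scaledPadding_letters`: the common deep padding of `FullPadding.lean` with ARBITRARY scales `c i ≥ 2` (gadget pair `i` =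
two positions carrying `X^{c_i s} + X^{2 c_i s}` on both sides): normalised, `t`-sparse, same `logSupport`, same valid weights, cells kept.
(2) `tower_letters_mem`, `tower_mem_span`, `tower_not_fibreSpread`: for ANY letter family `M` containing a binary tower (pairs `i < h` carrying
`2^{i+1}σ` at two positions and `2^{i+2}σ` at one of them), every letter set `L` confining the coincidences (val-idea-37's `LetterConfined`, text
verbatim) contains the tower letters, the saturated class of the pattern `e_{2^{h+1}σ}` contains `2^h · e_{2σ}`, and hence the fibre-spread bound
(val-idea-37's `FibreSpread`, text verbatim, `toZ`/`InSat`/`relLattice`/`realisedDiffs` unfolded) FAILS for every `Δ < 2^h`.  Used in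
`Negative/TowerPaddingResidual.lean`: the residual of `relation_ladder` after the R10 rung `ConfinedTameLaw C` is again `PlanarCellBound`.  [folklore]
-/

namespace Summit.ValiantsHypothesis.Theorems.TwoProducts.Negative.TowerPadding

open Finset MvPolynomial
open Summit.ValiantsHypothesis.ValiantsHypothesis.Theorems.NewtonUnitEquations.TwoProducts.FormalLogLinearisation
open Summit.ValiantsHypothesis.ValiantsHypothesis.Theorems.NewtonUnitEquations.TwoProducts.PlanarCell
open Summit.ValiantsHypothesis.ValiantsHypothesis.Theorems.NewtonUnitEquations.TwoProducts.PermutationType (msetT)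
open Summit.ValiantsHypothesis.Theorems.TwoProducts.Negative.CommonPadding

variable {m g : ℕ}

/-! ### Common gadget padding at arbitrary scales `c i ≥ 2` -/

/-- **Scaled common padding: specification** (verbatim `FullPadding.fullPadding_spec` with `2·5^i ↦ c i`, any `c i ≥ 2`). [folklore] -/
theorem scaledPadding_spec {t : ℕ} (ht : 2 ≤ t) (c : Fin g → ℕ) (hc : ∀ i, 2 ≤ c i) (u v : Fin m → MvPolynomial (Fin 2) ℂ)
    (hu : ∀ j, coeff 0 (u j) = 0 ∧ (u j).support.card ≤ t) (hv : ∀ j, coeff 0 (v j) = 0 ∧ (v j).support.card ≤ t)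
    (hT : (tailSupport u v).Nonempty) (z : Fin g → MvPolynomial (Fin 2) ℂ)
    (hz : z = fun i : Fin g => monomial (c i • ∑ f ∈ tailSupport u v, f) (1 : ℂ) + monomial ((2 * c i) • ∑ f ∈ tailSupport u v, f) 1) :
    (∀ j, coeff 0 (Fin.append u (Fin.append z z) j) = 0 ∧ (Fin.append u (Fin.append z z) j).support.card ≤ t) ∧
    (∀ j, coeff 0 (Fin.append v (Fin.append z z) j) = 0 ∧ (Fin.append v (Fin.append z z) j).support.card ≤ t) ∧
    logSupport (Fin.append u (Fin.append z z)) (Fin.append v (Fin.append z z)) = logSupport u v ∧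
    (∀ ξ, ValidWeight (Fin.append u (Fin.append z z)) (Fin.append v (Fin.append z z)) ξ ↔ ValidWeight u v ξ) ∧
    (∀ e ∈ tailSupport (Fin.append u (Fin.append z z)) (Fin.append v (Fin.append z z)),
      e ∈ tailSupport u v ∨ ∃ n, 2 ≤ n ∧ e = n • ∑ f ∈ tailSupport u v, f) ∧
    (∀ (R : Expo → Expo → Prop) (S : Finset Expo), IsCellFamily u v R S →
      ∃ R' : Expo → Expo → Prop, IsCellFamily (Fin.append u (Fin.append z z)) (Fin.append v (Fin.append z z)) R' S) := by
  classical
  have hu0 : ∀ j, coeff 0 (u j) = 0 := fun j => (hu j).1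
  have hv0 : ∀ j, coeff 0 (v j) = 0 := fun j => (hv j).1
  set s : Expo := ∑ f ∈ tailSupport u v, f with hs_def
  have hs0 : s ≠ 0 := tailSum_ne_zero hu0 hv0 hT
  have hc0 : ∀ i, c i ≠ 0 := fun i => by have := hc i; omega
  have hzi : ∀ i : Fin g, z i = monomial (c i • s) (1 : ℂ) + monomial ((2 * c i) • s) 1 := fun i => by rw [hz]
  have hzz : ∀ x : Fin (g + g), ∃ i : Fin g, Fin.append z z x = z i := by
    intro x
    induction x using Fin.addCases with
    | left i => exact ⟨i, Fin.append_left z z i⟩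
    | right i => exact ⟨i, Fin.append_right z z i⟩
  have hwsupp : ∀ x : Fin (g + g), ∀ e ∈ (Fin.append z z x).support, ∃ n, 2 ≤ n ∧ e = n • s := by
    intro x e he
    obtain ⟨i, hi⟩ := hzz x
    rw [hi, hzi] at he
    rcases mem_support_gadget he with h | h
    · exact ⟨_, hc i, h⟩
    · exact ⟨_, by have := hc i; omega, h⟩
  have hwnorm : ∀ x : Fin (g + g), coeff 0 (Fin.append z z x) = 0 ∧ (Fin.append z z x).support.card ≤ t := by
    intro x
    obtain ⟨i, hi⟩ := hzz x
    rw [hi, hzi]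
    exact ⟨coeff_zero_gadget hs0 (hc0 i), (card_support_gadget s _).trans ht⟩
  have hwtail : ∀ e ∈ tailSupport (Fin.append z z) (Fin.append z z), ∃ n, 2 ≤ n ∧ e = n • s := by
    intro e he
    unfold tailSupport at he
    simp only [Finset.mem_union, Finset.mem_biUnion, Finset.mem_univ, true_and, or_self] at he
    obtain ⟨x, hx⟩ := he
    exact hwsupp x e hx
  have hneg : ∀ ξ, ValidWeight u v ξ → ValidWeight (Fin.append z z) (Fin.append z z) ξ := by
    intro ξ hval
    have key : ∀ x, ∀ e ∈ (Fin.append z z x).support, wt ξ e < 0 := by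
      intro x e he
      obtain ⟨n, hn, rfl⟩ := hwsupp x e he
      rw [wt_nsmul]
      have hsneg := wt_tailSum_neg hval hT
      have hn' : (1 : ℝ) ≤ n := by exact_mod_cast (show 1 ≤ n by omega)
      nlinarith
    exact ⟨key, key⟩
  have hdeep : ∀ ξ, ValidWeight u v ξ → ∀ e ∈ tailSupport u v, ∀ e' ∈ tailSupport (Fin.append z z) (Fin.append z z),
      wt ξ e' < wt ξ e := by
    intro ξ hval e he e' he'
    obtain ⟨n, hn, rfl⟩ := hwtail e' he'
    exact wt_nsmul_tailSum_lt hval he hn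
  have hspos : 0 < s 0 + s 1 := by
    obtain ⟨d, hd⟩ := Finsupp.ne_iff.mp hs0
    simp only [Finsupp.coe_zero, Pi.zero_apply] at hd
    rcases (Fin.exists_fin_two (p := fun d => s d ≠ 0)).mp ⟨d, hd⟩ with h | h
    · omega
    · omega
  have hQ : ∀ ξ, ValidWeight u v ξ → ∀ e ∈ tailSupport (Fin.append z z) (Fin.append z z),
      ∀ e' ∈ tailSupport (Fin.append z z) (Fin.append z z), ((e' 0 + e' 1 ≤ e 0 + e 1) ↔ wt ξ e ≤ wt ξ e') := by
    intro ξ hval e he e' he'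
    obtain ⟨n, -, rfl⟩ := hwtail e he
    obtain ⟨n', -, rfl⟩ := hwtail e' he'
    rw [wt_nsmul_tailSum_le_iff hval hT]
    simp only [Finsupp.smul_apply, smul_eq_mul, ← mul_add]
    constructor
    · exact fun h => Nat.le_of_mul_le_mul_right h hspos
    · exact fun h => Nat.mul_le_mul_right _ h
  refine ⟨norm_append u _ hu hwnorm, norm_append v _ hv hwnorm, logSupport_append_common u v _, fun ξ => ?_, fun e he => ?_,
    fun R S hS => ⟨_, isCellFamily_append_common u v _ _ hneg hdeep hQ R S hS⟩⟩
  · rw [validWeight_append_iff]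
    exact ⟨fun h => h.1, fun h => ⟨h, hneg ξ h⟩⟩
  · rw [tailSupport_append, Finset.mem_union] at he
    rcases he with he | he
    · exact Or.inl he
    · exact Or.inr (hwtail e he)

/-- **Letters of the scaled padding**: pair `i` carries `c_i s` and `2 c_i s` at both of its positions. [folklore] -/
theorem scaledPadding_letters (c : Fin g → ℕ) (hc0 : ∀ i, c i ≠ 0) (u v : Fin m → MvPolynomial (Fin 2) ℂ)
    (hs0 : ∑ f ∈ tailSupport u v, f ≠ 0) (z : Fin g → MvPolynomial (Fin 2) ℂ)
    (hz : z = fun i : Fin g => monomial (c i • ∑ f ∈ tailSupport u v, f) (1 : ℂ) + monomial ((2 * c i) • ∑ f ∈ tailSupport u v, f) 1)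
    (i : Fin g) :
    (c i • ∑ f ∈ tailSupport u v, f ∈
        (Fin.append u (Fin.append z z) (Fin.natAdd m (Fin.castAdd g i))).support ∪
          (Fin.append v (Fin.append z z) (Fin.natAdd m (Fin.castAdd g i))).support ∧
      (2 * c i) • ∑ f ∈ tailSupport u v, f ∈
        (Fin.append u (Fin.append z z) (Fin.natAdd m (Fin.castAdd g i))).support ∪
          (Fin.append v (Fin.append z z) (Fin.natAdd m (Fin.castAdd g i))).support) ∧
    (c i • ∑ f ∈ tailSupport u v, f ∈
        (Fin.append u (Fin.append z z) (Fin.natAdd m (Fin.natAdd g i))).support ∪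
          (Fin.append v (Fin.append z z) (Fin.natAdd m (Fin.natAdd g i))).support ∧
      (2 * c i) • ∑ f ∈ tailSupport u v, f ∈
        (Fin.append u (Fin.append z z) (Fin.natAdd m (Fin.natAdd g i))).support ∪
          (Fin.append v (Fin.append z z) (Fin.natAdd m (Fin.natAdd g i))).support) := by
  have hzi : z i = monomial (c i • ∑ f ∈ tailSupport u v, f) (1 : ℂ) + monomial ((2 * c i) • ∑ f ∈ tailSupport u v, f) 1 := by
    rw [hz]
  simp only [Fin.append_right, Fin.append_left, Finset.union_idempotent, hzi]
  exact ⟨nsmul_mem_support_gadget hs0 (hc0 i), nsmul_mem_support_gadget hs0 (hc0 i)⟩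

/-! ### Binary towers violate every fibre-spread bound -/

variable {n h : ℕ}

/-- **A confining letter set contains the tower letters** (`LetterConfined M L` of val-idea-37, text verbatim): pair `i` realises the
coincidence `(2^{i+2}σ ∣ 0) ~ (2^{i+1}σ ∣ 2^{i+1}σ)`, which moves both letters. [folklore] -/
theorem tower_letters_mem (M : Fin n → Finset Expo) {σ : Expo} (hσ : σ ≠ 0) (p q : Fin h → Fin n) (hpq : ∀ i, p i ≠ q i)
    (hM : ∀ i : Fin h, 2 ^ ((i : ℕ) + 1) • σ ∈ M (p i) ∧ (2 * 2 ^ ((i : ℕ) + 1)) • σ ∈ M (p i) ∧ 2 ^ ((i : ℕ) + 1) • σ ∈ M (q i))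
    (L : Finset Expo)
    (hL : ∀ a ∈ tuples M, ∀ b ∈ tuples M, ∑ j, a j = ∑ j, b j → ∀ e ∉ L, msetT a e = msetT b e) (i : Fin h) :
    2 ^ ((i : ℕ) + 1) • σ ∈ L ∧ (2 * 2 ^ ((i : ℕ) + 1)) • σ ∈ L := by
  classical
  have hc0 : 2 ^ ((i : ℕ) + 1) ≠ 0 := by positivity
  obtain ⟨hb, ha, hsum, hmb, hma, -⟩ := planted_pair (hpq i) hσ hc0 (hM i).1 (hM i).2.1 (hM i).2.2
  have hne : (2 * 2 ^ ((i : ℕ) + 1)) • σ ≠ 2 ^ ((i : ℕ) + 1) • σ := nsmul_ne_nsmul hσ (by omega)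
  constructor
  · by_contra hnot
    have h1 := hL _ ha _ hb hsum.symm _ hnot
    rw [hma, hmb] at h1
    simp only [Finsupp.add_apply, Finsupp.single_apply, if_true, hne, if_false] at h1
    omega
  · by_contra hnot
    have h1 := hL _ ha _ hb hsum.symm _ hnot
    rw [hma, hmb] at h1
    simp only [Finsupp.add_apply, Finsupp.single_apply, if_true, hne.symm, if_false] at h1
    omega

/-- **Telescoping along the tower**: `2^j · e_{2σ} − e_{2^{j+1}σ}` lies in the realised relation lattice for every `j ≤ h`
(`relLattice` / `realisedDiffs` / `toZ` of val-idea-37, unfolded). [folklore] -/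
theorem tower_mem_span (M : Fin n → Finset Expo) {σ : Expo} (hσ : σ ≠ 0) (p q : Fin h → Fin n) (hpq : ∀ i, p i ≠ q i)
    (hM : ∀ i : Fin h, 2 ^ ((i : ℕ) + 1) • σ ∈ M (p i) ∧ (2 * 2 ^ ((i : ℕ) + 1)) • σ ∈ M (p i) ∧ 2 ^ ((i : ℕ) + 1) • σ ∈ M (q i)) :
    ∀ j : ℕ, j ≤ h →
      ((2 : ℤ) ^ j) • Finsupp.single ((2 : ℕ) • σ) (1 : ℤ) - Finsupp.single ((2 * 2 ^ j) • σ) 1 ∈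
        Submodule.span ℤ {z : Expo →₀ ℤ | ∃ a ∈ tuples M, ∃ b ∈ tuples M, ∑ j, a j = ∑ j, b j ∧
          z = Finsupp.mapRange (fun k : ℕ => (k : ℤ)) (by simp) (msetT a) - Finsupp.mapRange (fun k : ℕ => (k : ℤ)) (by simp) (msetT b)} := by
  classical
  intro j
  induction j with
  | zero =>
    intro _
    rw [pow_zero, one_smul, pow_zero, mul_one, sub_self]
    exact Submodule.zero_mem _
  | succ j ih =>
    intro hj
    have hjh : j < h := by omega
    set i : Fin h := ⟨j, hjh⟩ with hi_def
    have hc0 : 2 ^ ((i : ℕ) + 1) ≠ 0 := by positivity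
    obtain ⟨hb, ha, hsum, hmb, hma, -⟩ := planted_pair (hpq i) hσ hc0 (hM i).1 (hM i).2.1 (hM i).2.2
    -- the relation of pair `i = j`: `2 e_{2^{j+1}σ} − e_{2^{j+2}σ}`
    have hr : (Finsupp.single (2 ^ (j + 1) • σ) (1 : ℤ) + Finsupp.single (2 ^ (j + 1) • σ) 1) -
        Finsupp.single ((2 * 2 ^ (j + 1)) • σ) 1 ∈
        Submodule.span ℤ {z : Expo →₀ ℤ | ∃ a ∈ tuples M, ∃ b ∈ tuples M, ∑ j, a j = ∑ j, b j ∧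
          z = Finsupp.mapRange (fun k : ℕ => (k : ℤ)) (by simp) (msetT a) -
            Finsupp.mapRange (fun k : ℕ => (k : ℤ)) (by simp) (msetT b)} := by
      refine Submodule.subset_span ⟨_, ha, _, hb, hsum.symm, ?_⟩
      rw [hma, hmb, Finsupp.mapRange_add (fun x y => by push_cast; rfl), Finsupp.mapRange_single, Finsupp.mapRange_single]
      simp [hi_def]
    have hprev := ih (by omega)
    have key : ((2 : ℤ) ^ (j + 1)) • Finsupp.single ((2 : ℕ) • σ) (1 : ℤ) - Finsupp.single ((2 * 2 ^ (j + 1)) • σ) 1 =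
        (2 : ℤ) • (((2 : ℤ) ^ j) • Finsupp.single ((2 : ℕ) • σ) (1 : ℤ) - Finsupp.single ((2 * 2 ^ j) • σ) 1) +
          ((Finsupp.single (2 ^ (j + 1) • σ) (1 : ℤ) + Finsupp.single (2 ^ (j + 1) • σ) 1) -
            Finsupp.single ((2 * 2 ^ (j + 1)) • σ) 1) := by
      rw [show (2 * 2 ^ j) • σ = 2 ^ (j + 1) • σ from by rw [pow_succ'], smul_sub, smul_smul,
        show ((2 : ℤ) * 2 ^ j) = 2 ^ (j + 1) from by ring]
      abel
    rw [key]
    exact Submodule.add_mem _ (Submodule.smul_mem _ _ hprev) hr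

/-- **Towers violate the fibre-spread bound** (`FibreSpread M L Δ` of val-idea-37, text verbatim with `InSat`/`relLattice`/`realisedDiffs`/`toZ`
unfolded): with a binary tower of `h ≥ 1` pairs and any confining `L`, the pattern `e_{2^{h+1}σ}` (the `L`-part of a tuple multiset) is
saturation-equivalent to `2^h · e_{2σ}`, of mass `2^h > Δ`. [folklore] -/
theorem tower_not_fibreSpread (M : Fin n → Finset Expo) {σ : Expo} (hσ : σ ≠ 0) (p q : Fin h → Fin n) (hpq : ∀ i, p i ≠ q i)
    (hM : ∀ i : Fin h, 2 ^ ((i : ℕ) + 1) • σ ∈ M (p i) ∧ (2 * 2 ^ ((i : ℕ) + 1)) • σ ∈ M (p i) ∧ 2 ^ ((i : ℕ) + 1) • σ ∈ M (q i))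
    (hh : 1 ≤ h) (L : Finset Expo)
    (hL : ∀ a ∈ tuples M, ∀ b ∈ tuples M, ∑ j, a j = ∑ j, b j → ∀ e ∉ L, msetT a e = msetT b e)
    (Δ : ℕ) (hΔ : Δ < 2 ^ h) :
    ¬ (∀ a ∈ tuples M, ∀ y : Expo →₀ ℕ, y.support ⊆ L →
        (∃ k : ℕ, 0 < k ∧ ((k : ℤ) • (Finsupp.mapRange (fun k : ℕ => (k : ℤ)) (by simp) y -
          Finsupp.mapRange (fun k : ℕ => (k : ℤ)) (by simp) ((msetT a).filter (· ∈ L)))) ∈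
          Submodule.span ℤ {z : Expo →₀ ℤ | ∃ a ∈ tuples M, ∃ b ∈ tuples M, ∑ j, a j = ∑ j, b j ∧
            z = Finsupp.mapRange (fun k : ℕ => (k : ℤ)) (by simp) (msetT a) -
              Finsupp.mapRange (fun k : ℕ => (k : ℤ)) (by simp) (msetT b)}) →
        (y.sum fun _ k => k) ≤ Δ) := by
  classical
  intro hF
  obtain ⟨h', rfl⟩ : ∃ h', h = h' + 1 := ⟨h - 1, by omega⟩
  set iL : Fin (h' + 1) := Fin.last h' with hiL
  have hc0 : 2 ^ ((iL : ℕ) + 1) ≠ 0 := by positivity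
  obtain ⟨hb, -, -, hmb, -, -⟩ := planted_pair (hpq iL) hσ hc0 (hM iL).1 (hM iL).2.1 (hM iL).2.2
  -- the top letter and the bottom letter are in `L`
  have htop : (2 * 2 ^ ((iL : ℕ) + 1)) • σ ∈ L := (tower_letters_mem M hσ p q hpq hM L hL iL).2
  have hbot : (2 : ℕ) • σ ∈ L := by
    have := (tower_letters_mem M hσ p q hpq hM L hL ⟨0, by omega⟩).1
    simpa using this
  have h2h : (2 ^ (h' + 1) : ℕ) ≠ 0 := by positivity
  -- the witness pattern `y = 2^h · e_{2σ}`
  have hmass : ((Finsupp.single ((2 : ℕ) • σ) (2 ^ (h' + 1) : ℕ)).sum fun _ k => k) = 2 ^ (h' + 1) := by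
    rw [Finsupp.sum_single_index]; rfl
  have hsupp : (Finsupp.single ((2 : ℕ) • σ) (2 ^ (h' + 1) : ℕ)).support ⊆ L :=
    Finsupp.support_single_subset.trans (Finset.singleton_subset_iff.2 hbot)
  have hfilter : (msetT (Pi.single (p iL) ((2 * 2 ^ ((iL : ℕ) + 1)) • σ) + Pi.single (q iL) (0 : Expo) : Fin n → Expo)).filter
      (· ∈ L) = Finsupp.single ((2 * 2 ^ ((iL : ℕ) + 1)) • σ) 1 := by
    rw [hmb, Finsupp.filter_single_of_pos _ htop]
  have hsat := tower_mem_span M hσ p q hpq hM (h' + 1) le_rfl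
  have hy := hF _ hb (Finsupp.single ((2 : ℕ) • σ) (2 ^ (h' + 1) : ℕ)) hsupp ⟨1, one_pos, ?_⟩
  · rw [hmass] at hy
    omega
  · rw [hfilter, Nat.cast_one, one_smul, Finsupp.mapRange_single, Finsupp.mapRange_single]
    have e1 : Finsupp.single ((2 : ℕ) • σ) (((2 ^ (h' + 1) : ℕ) : ℤ)) = ((2 : ℤ) ^ (h' + 1)) • Finsupp.single ((2 : ℕ) • σ) (1 : ℤ) := by
      rw [Finsupp.smul_single, smul_eq_mul, mul_one]; push_cast; rfl
    have e2 : (iL : ℕ) = h' := by simp [hiL]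
    rw [e1, e2, Nat.cast_one]
    exact hsat

end Summit.ValiantsHypothesis.Theorems.TwoProducts.Negative.TowerPadding
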